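import Summits.Ventures.CertifiedManyBodySolver.Theorems.TcThermcert1SeamTwistInputs
import Summits.Ventures.CertifiedManyBodySolver.Theorems.TcThermcert1QbpLocalPerturbation
import Summits.Ventures.CertifiedManyBodySolver.Theorems.TcThermcert1QbpSectorBookkeeping
import Literature.MathematicalPhysics.QuantumLattice.ApproximatingHamiltonianProofs
import HarnessLib

/-!
# Time-reversal blindness of the current covariance (negative-side helper for the cruxes K1′ / K1 of route `TcThermcert1`)

Disprover's helper (`--supports stmt-Ventures-24560`; crux K1′ `TcThermcert1.ThermalStiffnessCeilingU8b8_le_7o44`, line of record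
`Cruxes/ThermalStiffnessCeilingU8b8_le_7o44/Lines/gauge_qbp_far_seam.lean` v1.3, bet C8 `stub_currentClustering8`; equally the K1 twin's C10).
Hypothesis C of that line bounds, in the canonical-sector Gibbs state of the flux-FREE torus `hubbardTorusTT'Flux L 0 U 0`, the covariance
`ω_p(A·j) − ω_p(A)·ω_p(j)` of an even local observable `A` with the plain bond current
`j = Σ_σ (−i c†_{(X,y)σ} c_{(X−1,y)σ} + i c†_{(X−1,y)σ} c_{(X,y)σ})`. Stated here over the tree's literal operators and an ARBITRARY coordinate
predicate `p` (so the line file, whose `sectorExpect` / `bondCurrent` are these terms at `p = sectorPred`, can `unfold; exact`):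

* `gibbsState_fluxZeroBlock_farBond_eq_zero` — `ω_p(j) = 0` EXACTLY (real part: time reversal, tree `re_gibbsState_fluxZeroBlock_farBond_eq_zero`;
  imaginary part: `j` and the Hamiltonian block are Hermitian). So the product term of the covariance vanishes identically.
* `gibbsCov_fluxZeroBlock_farBond_eq_zero_of_trEven` — for every entrywise-REAL HERMITIAN `A` (time-reversal even: spin, density,
  density–density, bond-kinetic, stripe / SDW / CDW order parameters) commuting with `j` (e.g. supported off the bond), the covariance is
  EXACTLY `0`, at every `U`, `β`, `L`, `p`. Negative knowledge for the bet: no time-reversal-even dataset (e.g. the printed stripe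
  thermodynamics of the `(U, δ) = (8, 1/8)` model, arXiv:2202.11741) can price Hypothesis C; only time-reversal-ODD quasi-order can refute it.
* `norm_gibbsCov_fluxZeroBlock_farBond_le` — the a-priori bound `‖Cov‖ ≤ 4‖A‖` (so C has content only where `C|X|^k e^{−d/ξ} < 4`).

HONEST FRAMING: finite-dimensional folklore (time reversal = entrywise complex conjugation in the occupation basis); it proves NOTHING about
clustering at `U = 8`, and superconductivity in the Hubbard model is neither proved nor disproved by anything in this file.
-/

noncomputable section

open scoped ComplexOrder ComplexConjugate Matrix.Norms.L2Operator
open Matrix Finset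
open Literature.MathematicalPhysics.QuantumLattice
open Literature.Probability.LatticeModels
open Summit.Ventures.CertifiedManyBodySolver.Theorems.TcThermcert1.GaugeQbpFarSeam

namespace Summit.Ventures.CertifiedManyBodySolver.Theorems.TcThermcert1.CurrentCovarianceTRBlind

section Generic

variable {Λ : Type*} [LinearOrder Λ] [Fintype Λ]

/-- The plain two-spin bond current `Σ_σ (−i c†_{aσ} c_{bσ} + i c†_{bσ} c_{aσ})` is Hermitian. [folklore] -/
theorem isHermitian_farBond (a b : Λ) :
    (∑ σ : Fin 2, ((-Complex.I) • (creation (orb a σ) * annihilation (orb b σ)) +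
        Complex.I • (creation (orb b σ) * annihilation (orb a σ))) : Matrix (Finset (Orb Λ)) (Finset (Orb Λ)) ℂ).IsHermitian := by
  unfold Matrix.IsHermitian
  rw [conjTranspose_sum]
  refine Finset.sum_congr rfl fun σ _ => ?_
  rw [conjTranspose_add, conjTranspose_smul, conjTranspose_smul, conjTranspose_mul, conjTranspose_mul,
    creation_conjTranspose, annihilation_conjTranspose, creation_conjTranspose, annihilation_conjTranspose,
    star_neg, Complex.star_def, Complex.conj_I, neg_neg, add_comm]

end Generic

variable (L : ℕ) [NeZero L]

/-- **`⟨j⟩ = 0` in the flux-free canonical sector state, exactly.** In the compressed Gibbs state of ANY coordinate sector `p` of the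
flux-free torus `hubbardTorusTT'Flux L 0 U 0` the expectation of the plain bond current through `(X−1,y)–(X,y)` is `0`: its real part
vanishes by time reversal (`re_gibbsState_fluxZeroBlock_farBond_eq_zero`) and it is real because the current and the Hamiltonian block are
Hermitian (`gibbsState_eq_re`). [folklore] -/
theorem gibbsState_fluxZeroBlock_farBond_eq_zero (U β : ℝ) (X y : ZMod L)
    (p : Finset (Orb (FermionTorus 2 L)) → Prop) [DecidablePred p] :
    gibbsState β ((hubbardTorusTT'Flux L 0 U 0).toBlock p p)
        ((∑ σ : Fin 2,
            ((-Complex.I) • (creation (orb (FermionTorus.ofTorusSite (![X, y] : TorusSite 2 L)) σ) *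
                annihilation (orb (FermionTorus.ofTorusSite (![X - 1, y] : TorusSite 2 L)) σ)) +
              Complex.I • (creation (orb (FermionTorus.ofTorusSite (![X - 1, y] : TorusSite 2 L)) σ) *
                annihilation (orb (FermionTorus.ofTorusSite (![X, y] : TorusSite 2 L)) σ)))).toBlock p p) = 0 := by
  rw [gibbsState_eq_re (isHermitian_toBlock _ (isHermitian_hubbardTorusTT'Flux L 0 U 0)) β
    (isHermitian_toBlock _ (isHermitian_farBond _ _)), re_gibbsState_fluxZeroBlock_farBond_eq_zero L U β X y p, Complex.ofReal_zero]

/-- **TIME-REVERSAL BLINDNESS of the current covariance.** For every entrywise-real Hermitian `A` (time-reversal even) commuting with the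
bond current `j`, the connected correlation `ω_p(A·j) − ω_p(A)·ω_p(j)` in the compressed Gibbs state of ANY coordinate sector `p` of the
flux-free torus is EXACTLY `0` (every `U`, `β`, `L`): `ω_p(j) = 0` by the previous theorem; `A·j` is entrywise imaginary and Hermitian, so
`ω_p(A·j)` has zero real part (`re_gibbsState_eq_zero_of_map_starRingEnd`) and is real. [folklore] -/
theorem gibbsCov_fluxZeroBlock_farBond_eq_zero_of_trEven (U β : ℝ) (X y : ZMod L)
    (p : Finset (Orb (FermionTorus 2 L)) → Prop) [DecidablePred p]
    {A : Matrix (Finset (Orb (FermionTorus 2 L))) (Finset (Orb (FermionTorus 2 L))) ℂ}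
    (hAr : A.map (starRingEnd ℂ) = A) (hAh : A.IsHermitian)
    (hc : A * (∑ σ : Fin 2,
            ((-Complex.I) • (creation (orb (FermionTorus.ofTorusSite (![X, y] : TorusSite 2 L)) σ) *
                annihilation (orb (FermionTorus.ofTorusSite (![X - 1, y] : TorusSite 2 L)) σ)) +
              Complex.I • (creation (orb (FermionTorus.ofTorusSite (![X - 1, y] : TorusSite 2 L)) σ) *
                annihilation (orb (FermionTorus.ofTorusSite (![X, y] : TorusSite 2 L)) σ)))) =
      (∑ σ : Fin 2,
            ((-Complex.I) • (creation (orb (FermionTorus.ofTorusSite (![X, y] : TorusSite 2 L)) σ) *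
                annihilation (orb (FermionTorus.ofTorusSite (![X - 1, y] : TorusSite 2 L)) σ)) +
              Complex.I • (creation (orb (FermionTorus.ofTorusSite (![X - 1, y] : TorusSite 2 L)) σ) *
                annihilation (orb (FermionTorus.ofTorusSite (![X, y] : TorusSite 2 L)) σ)))) * A) :
    gibbsState β ((hubbardTorusTT'Flux L 0 U 0).toBlock p p)
          ((A * (∑ σ : Fin 2,
            ((-Complex.I) • (creation (orb (FermionTorus.ofTorusSite (![X, y] : TorusSite 2 L)) σ) *
                annihilation (orb (FermionTorus.ofTorusSite (![X - 1, y] : TorusSite 2 L)) σ)) +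
              Complex.I • (creation (orb (FermionTorus.ofTorusSite (![X - 1, y] : TorusSite 2 L)) σ) *
                annihilation (orb (FermionTorus.ofTorusSite (![X, y] : TorusSite 2 L)) σ))))).toBlock p p)
      - gibbsState β ((hubbardTorusTT'Flux L 0 U 0).toBlock p p) (A.toBlock p p)
        * gibbsState β ((hubbardTorusTT'Flux L 0 U 0).toBlock p p)
          ((∑ σ : Fin 2,
            ((-Complex.I) • (creation (orb (FermionTorus.ofTorusSite (![X, y] : TorusSite 2 L)) σ) *
                annihilation (orb (FermionTorus.ofTorusSite (![X - 1, y] : TorusSite 2 L)) σ)) +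
              Complex.I • (creation (orb (FermionTorus.ofTorusSite (![X - 1, y] : TorusSite 2 L)) σ) *
                annihilation (orb (FermionTorus.ofTorusSite (![X, y] : TorusSite 2 L)) σ)))).toBlock p p) = 0 := by
  rw [gibbsState_fluxZeroBlock_farBond_eq_zero, mul_zero, sub_zero]
  have hJ := isHermitian_farBond (FermionTorus.ofTorusSite (![X, y] : TorusSite 2 L))
    (FermionTorus.ofTorusSite (![X - 1, y] : TorusSite 2 L))
  have hAJ : (A * (∑ σ : Fin 2,
            ((-Complex.I) • (creation (orb (FermionTorus.ofTorusSite (![X, y] : TorusSite 2 L)) σ) *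
                annihilation (orb (FermionTorus.ofTorusSite (![X - 1, y] : TorusSite 2 L)) σ)) +
              Complex.I • (creation (orb (FermionTorus.ofTorusSite (![X - 1, y] : TorusSite 2 L)) σ) *
                annihilation (orb (FermionTorus.ofTorusSite (![X, y] : TorusSite 2 L)) σ))))).IsHermitian := by
    unfold Matrix.IsHermitian
    rw [conjTranspose_mul, hJ.eq, hAh.eq]
    exact hc.symm
  have hre : (gibbsState β ((hubbardTorusTT'Flux L 0 U 0).toBlock p p)
          ((A * (∑ σ : Fin 2,
            ((-Complex.I) • (creation (orb (FermionTorus.ofTorusSite (![X, y] : TorusSite 2 L)) σ) *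
                annihilation (orb (FermionTorus.ofTorusSite (![X - 1, y] : TorusSite 2 L)) σ)) +
              Complex.I • (creation (orb (FermionTorus.ofTorusSite (![X - 1, y] : TorusSite 2 L)) σ) *
                annihilation (orb (FermionTorus.ofTorusSite (![X, y] : TorusSite 2 L)) σ))))).toBlock p p)).re = 0 := by
    apply re_gibbsState_eq_zero_of_map_starRingEnd
    · rw [Theorems.TcThermcert1.GaugeQbpFarSeam.toBlock_map, hubbardTorusTT'Flux_tPrime_zero, hubbardTorusFlux_map_conj, neg_zero]
    · rw [Theorems.TcThermcert1.GaugeQbpFarSeam.toBlock_map, Matrix.map_mul, hAr, farBond_map_conj, mul_neg, neg_toBlock]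
  rw [gibbsState_eq_re (isHermitian_toBlock _ (isHermitian_hubbardTorusTT'Flux L 0 U 0)) β (isHermitian_toBlock _ hAJ), hre,
    Complex.ofReal_zero]

/-- **A-priori bound `‖Cov‖ ≤ 4‖A‖`** on the current covariance (the product term is `0`; `‖ω_p(A·j)‖ ≤ ‖A·j‖ ≤ 4‖A‖`; an empty sector
gives Lean's `gibbsState = 0`). Hypothesis C therefore has content only in the regime `C |X|^k e^{−d/ξ} < 4`. [folklore] -/
theorem norm_gibbsCov_fluxZeroBlock_farBond_le (U β : ℝ) (X y : ZMod L)
    (p : Finset (Orb (FermionTorus 2 L)) → Prop) [DecidablePred p]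
    (A : Matrix (Finset (Orb (FermionTorus 2 L))) (Finset (Orb (FermionTorus 2 L))) ℂ) :
    ‖gibbsState β ((hubbardTorusTT'Flux L 0 U 0).toBlock p p)
          ((A * (∑ σ : Fin 2,
            ((-Complex.I) • (creation (orb (FermionTorus.ofTorusSite (![X, y] : TorusSite 2 L)) σ) *
                annihilation (orb (FermionTorus.ofTorusSite (![X - 1, y] : TorusSite 2 L)) σ)) +
              Complex.I • (creation (orb (FermionTorus.ofTorusSite (![X - 1, y] : TorusSite 2 L)) σ) *
                annihilation (orb (FermionTorus.ofTorusSite (![X, y] : TorusSite 2 L)) σ))))).toBlock p p)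
      - gibbsState β ((hubbardTorusTT'Flux L 0 U 0).toBlock p p) (A.toBlock p p)
        * gibbsState β ((hubbardTorusTT'Flux L 0 U 0).toBlock p p)
          ((∑ σ : Fin 2,
            ((-Complex.I) • (creation (orb (FermionTorus.ofTorusSite (![X, y] : TorusSite 2 L)) σ) *
                annihilation (orb (FermionTorus.ofTorusSite (![X - 1, y] : TorusSite 2 L)) σ)) +
              Complex.I • (creation (orb (FermionTorus.ofTorusSite (![X - 1, y] : TorusSite 2 L)) σ) *
                annihilation (orb (FermionTorus.ofTorusSite (![X, y] : TorusSite 2 L)) σ)))).toBlock p p)‖ ≤ 4 * ‖A‖ := by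
  rw [gibbsState_fluxZeroBlock_farBond_eq_zero, mul_zero, sub_zero]
  have hH := isHermitian_hubbardTorusTT'Flux L 0 U 0
  have hAJ : ‖A * (∑ σ : Fin 2,
            ((-Complex.I) • (creation (orb (FermionTorus.ofTorusSite (![X, y] : TorusSite 2 L)) σ) *
                annihilation (orb (FermionTorus.ofTorusSite (![X - 1, y] : TorusSite 2 L)) σ)) +
              Complex.I • (creation (orb (FermionTorus.ofTorusSite (![X - 1, y] : TorusSite 2 L)) σ) *
                annihilation (orb (FermionTorus.ofTorusSite (![X, y] : TorusSite 2 L)) σ))))‖ ≤ 4 * ‖A‖ :=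
    calc _ ≤ ‖A‖ * ‖(∑ σ : Fin 2,
            ((-Complex.I) • (creation (orb (FermionTorus.ofTorusSite (![X, y] : TorusSite 2 L)) σ) *
                annihilation (orb (FermionTorus.ofTorusSite (![X - 1, y] : TorusSite 2 L)) σ)) +
              Complex.I • (creation (orb (FermionTorus.ofTorusSite (![X - 1, y] : TorusSite 2 L)) σ) *
                annihilation (orb (FermionTorus.ofTorusSite (![X, y] : TorusSite 2 L)) σ))))‖ := norm_mul_le _ _
      _ ≤ ‖A‖ * 4 := by gcongr; exact norm_farBond_le _ _
      _ = 4 * ‖A‖ := mul_comm _ _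
  rcases isEmpty_or_nonempty {s // p s} with he | hne
  · have h0 : ∀ B : Matrix {s // p s} {s // p s} ℂ, gibbsState β ((hubbardTorusTT'Flux L 0 U 0).toBlock p p) B = 0 := by
      intro B
      rw [gibbsState_apply]
      simp [Matrix.trace]
    rw [h0, norm_zero]
    positivity
  · exact ((norm_gibbsState_le (isHermitian_toBlock _ hH) β _).trans (norm_toBlock_le_of_le _ le_rfl)).trans hAJ

end Summit.Ventures.CertifiedManyBodySolver.Theorems.TcThermcert1.CurrentCovarianceTRBlind

end
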